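import Summits.Ventures.CertifiedArithmetic.Expansions.WeakExpansionAdjacency

/-!
# Weakly nonoverlapping expansions, part 6 (§10–§11): Theorem 2, closure under FAST-EXPANSION-SUM

HONEST FRAMING (ENGINES group, unit `eng-quad-4`, kernels lane of the `certquad` engine — shared
numerical engines serving client cells; rigour lives in the verifiers; every published number
belongs to a client cell's ledger, not to the engines group): NEW WORK of the lane's Lean line, not a
published result, hence under `Summits/Ventures/` with no citation tag; nothing here is cited anywhere
as a literature fact.  Overview, statements in words, evidence and the proof outline (§1–§11):
module docstring of `WeakExpansion.lean` in this directory.  This file introduces no definitions.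

CONTENTS.  §10 `FesInvW.adjFacts`, `FesInvW.advance₂` (a loop step under a rounding whose roundoff is
2-below its result, e.g. round-half-even, with the adjacency record `AdjFacts` of part 1); §11 the
induction `FesInvW.isWeakExpansion_growExpansion` (carrying the adjacency witness `AdjW` of part 1),
THEOREM 2 `fastExpansionSum_isWeakExpansion` (weakly nonoverlapping in ⇒ weakly nonoverlapping out,
`p ≥ 4`, `RoundoffBelow 2 fl`), `fastExpansionSum_isWeakExpansion_roundTiesEven` and the combined
`fastExpansionSum_spec_roundTiesEven` (Theorems 1 + 2: FAST-EXPANSION-SUM is composable on the class).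
-/

namespace Summit.Ventures.CertifiedArithmetic.Expansions

open Literature.ComputerArithmetic.JeannerodRump2018
open Literature.ComputerArithmetic.BoldoJeannerodMelquiondMuller2023 hiding twoSum twoSum_fst isFloat_twoSum
open Literature.ComputerArithmetic.Shewchuk1997

variable {p : ℕ} {emin : ℤ} {fl : ℚ → ℚ}

/-! ### §10  One loop step under a rounding whose roundoff is 2-below the result (round-half-even)

Besides the strengthened invariant, Theorem 2's induction records for a nonzero output `h`
(`T = ⌊log₂|h|⌋`): the new accumulator is a multiple of `2^(T+2)` (TWO-SUM's roundoff is 2-below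
its result, Corollary 9 — this is where round-half-EVEN enters); EITHER all unprocessed components are
multiples of `2^(T+2)` OR `|h| = 2^T` and some unprocessed component is an odd multiple of `2^(T+1)`
(§8); and no two unprocessed components are odd multiples of `2^(T+1)` and of `2^(T+2)` (§9). -/

/-- The adjacency facts of a nonzero output, from §8, §9 and the 2-below roundoff of TWO-SUM
(oriented state; `rs` is any list with the same members as the unprocessed components). -/
theorem FesInvW.adjFacts (hp : 4 ≤ p) (hfl : IsRoundNearest p emin fl) (hfl2 : RoundoffBelow 2 fl)
    {e f e₁ f₁ e₂' f₂ : List ℚ} {z Q : ℚ} {hs : List ℚ} {g : ℤ}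
    (heF : ∀ x ∈ e, IsFloat p emin x) (hes : IsWeakExpansion e)
    (hfF : ∀ x ∈ f, IsFloat p emin x) (hfs : IsWeakExpansion f)
    (hI : FesInvW p emin e f e₁ f₁ (z :: e₂') f₂ Q hs g) (hzle : ∀ x ∈ f₂, x ≠ 0 → |z| ≤ |x|)
    {rs : List ℚ} (hmem : ∀ x, x ∈ rs ↔ x ∈ e₂' ++ f₂)
    {Q' h : ℚ} (hQ' : (twoSum fl Q z).1 = Q') (hh : (twoSum fl Q z).2 = h) (hh0 : h ≠ 0)
    {T : ℤ} (hT : Int.log 2 |h| = T) (hrg' : ∀ x ∈ e₂' ++ f₂, OnGrid (T + 1) x) :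
    AdjFacts rs Q' h T := by
  have hp1 : 1 ≤ p := le_trans (by norm_num) hp
  have hp3 : 3 ≤ p := le_trans (by norm_num) hp
  have h2 : (0 : ℚ) < 2 := by norm_num
  have hzF : IsFloat p emin z := heF z (by rw [hI.inv.he]; simp)
  obtain ⟨-, -, -, -, -, -, hTh, -, -, -, -, -, -⟩ :=
    FesInvW.prelude hp1 hfl heF hI.inv hQ' hh hh0 hT
  have he' : e = (e₁ ++ [z]) ++ e₂' := by rw [hI.inv.he]; simp
  -- the new accumulator: TWO-SUM's roundoff is 2-below its result
  have gridQ : OnGrid (T + 2) Q' := by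
    have hb2 : Below 2 h Q' := by
      have := twoSum_below hp1 hfl hfl2 hI.inv.hQ hzF; rwa [hQ', hh] at this
    obtain ⟨s, hs, hlt⟩ := hb2
    have hTs : T + 2 ≤ s := by
      have : (2 : ℚ) ^ (T + 1) < (2 : ℚ) ^ s := by rw [zpow_add_one₀ h2.ne']; linarith
      have := (zpow_lt_zpow_iff_right₀ (by norm_num : (1:ℚ) < 2)).mp this; omega
    exact hs.mono hTs
  have hmem' : ∀ x ∈ rs, x ∈ e₂' ++ f₂ := fun x hx => (hmem x).mp hx
  refine ⟨gridQ, ?_, fun x hx y hy Mx My hMx hMy hxe hye =>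
    hI.claimN hp3 hfl heF hes hfF hfs hzle hQ' hh hh0 hT (hmem' x hx) (hmem' y hy) hMx hMy hxe hye⟩
  rcases hI.lower_member hp hfl heF hes hfF hfs hzle hQ' hh hh0 hT hrg' with ⟨-, hall⟩ | habs
  · exact Or.inl fun x hx => hall x (hmem' x hx)
  · by_cases hall : ∀ x ∈ e₂' ++ f₂, OnGrid (T + 2) x
    · exact Or.inl fun x hx => hall x (hmem' x hx)
    · right
      refine ⟨habs, ?_⟩
      push Not at hall
      obtain ⟨x₀, hx₀, hnot⟩ := hall
      have hx₀0 : x₀ ≠ 0 := fun h0 => hnot (h0 ▸ OnGrid.zero _)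
      have hx₀F : IsFloat p emin x₀ := by
        rcases List.mem_append.mp hx₀ with hx | hx
        · exact heF x₀ (by rw [he']; exact List.mem_append_right _ hx)
        · exact hfF x₀ (by rw [hI.inv.hf]; exact List.mem_append_right _ hx)
      obtain ⟨M₀, j, hM₀, -, -, hx₀e⟩ := exists_odd_mul_two_zpow hx₀F hx₀0
      obtain rfl : j = T + 1 := by
        have h1 : T + 1 ≤ j := OnGrid.le_of_odd hM₀ (by rw [← hx₀e]; exact hrg' x₀ hx₀)
        have h2' : ¬ (T + 2 ≤ j) := fun hle => hnot (OnGrid.mono ⟨M₀, hx₀e⟩ hle)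
        omega
      exact ⟨x₀, (hmem x₀).mpr hx₀, M₀, hM₀, hx₀e⟩

/-- One loop step (cf. `FesInvW.advance`), with the adjacency facts for a nonzero output. -/
theorem FesInvW.advance₂ (hp : 4 ≤ p) (hfl : IsRoundNearest p emin fl) (hfl2 : RoundoffBelow 2 fl)
    {e f : List ℚ} (heF : ∀ x ∈ e, IsFloat p emin x) (hes : IsWeakExpansion e)
    (hfF : ∀ x ∈ f, IsFloat p emin x) (hfs : IsWeakExpansion f)
    {z : ℚ} {rs e₁ f₁ e₂ f₂ : List ℚ} {Q : ℚ} {hs : List ℚ} {g : ℤ}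
    (hm : mergeExpansions e₂ f₂ = z :: rs) (hI : FesInvW p emin e f e₁ f₁ e₂ f₂ Q hs g) :
    ∃ (e₁' f₁' e₂' f₂' : List ℚ) (g' : ℤ), mergeExpansions e₂' f₂' = rs ∧
      FesInvW p emin e f e₁' f₁' e₂' f₂' (twoSum fl Q z).1 (hs ++ [(twoSum fl Q z).2]) g' ∧
      |(twoSum fl Q z).2| < (2 : ℚ) ^ g' ∧
      ((twoSum fl Q z).2 ≠ 0 → g' = Int.log 2 |(twoSum fl Q z).2| + 1 ∧
        AdjFacts rs (twoSum fl Q z).1 (twoSum fl Q z).2 (Int.log 2 |(twoSum fl Q z).2|)) := by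
  rcases mergeExpansions_eq_cons hm with ⟨e₂', rfl, hrs, hhead⟩ | ⟨f₂', rfl, hrs, hhead⟩
  · have hzle : ∀ x ∈ f₂, x ≠ 0 → |z| ≤ |x| := by
      intro x hx hx0
      cases f₂ with
      | nil => simp at hx
      | cons y ys =>
        have hzy := hhead y ys rfl
        rcases List.mem_cons.mp hx with rfl | hx
        · exact hzy
        · have hpw := hfs.1
          rw [hI.inv.hf, List.pairwise_append, List.pairwise_cons] at hpw
          exact le_trans hzy ((hpw.2.1.1 x hx).abs_lt hx0).le
    obtain ⟨g', hI', hlt, hg'⟩ := hI.step hp hfl heF hes hfF hfs hzle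
    refine ⟨_, _, _, _, g', hrs.symm, hI', hlt, fun hh0 => ⟨hg' hh0, ?_⟩⟩
    have hmem : ∀ x, x ∈ rs ↔ x ∈ e₂' ++ f₂ := fun x => by
      rw [hrs, mem_mergeExpansions, List.mem_append]
    have hrg' : ∀ x ∈ e₂' ++ f₂, OnGrid (Int.log 2 |(twoSum fl Q z).2| + 1) x := fun x hx => by
      rw [← hg' hh0]; exact hI'.inv.hrg x hx
    exact hI.adjFacts hp hfl hfl2 heF hes hfF hfs hzle hmem rfl rfl hh0 rfl hrg'
  · have hzle : ∀ x ∈ e₂, x ≠ 0 → |z| ≤ |x| := by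
      intro x hx hx0
      cases e₂ with
      | nil => simp at hx
      | cons y ys =>
        have hzy := hhead y ys rfl
        rcases List.mem_cons.mp hx with rfl | hx
        · exact hzy.le
        · have hpw := hes.1
          rw [hI.inv.he, List.pairwise_append, List.pairwise_cons] at hpw
          exact le_trans hzy.le ((hpw.2.1.1 x hx).abs_lt hx0).le
    obtain ⟨g', hI', hlt, hg'⟩ := hI.swap.step hp hfl hfF hfs heF hes hzle
    refine ⟨_, _, _, _, g', hrs.symm, hI'.swap, hlt, fun hh0 => ⟨hg' hh0, ?_⟩⟩
    have hmem : ∀ x, x ∈ rs ↔ x ∈ f₂' ++ e₂ := fun x => by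
      rw [hrs, mem_mergeExpansions, List.mem_append, or_comm]
    have hrg' : ∀ x ∈ f₂' ++ e₂, OnGrid (Int.log 2 |(twoSum fl Q z).2| + 1) x := fun x hx => by
      rw [← hg' hh0]; exact hI'.inv.hrg x hx
    exact hI.swap.adjFacts hp hfl hfl2 hfF hfs heF hes hzle hmem rfl rfl hh0 rfl hrg'

/-! ### §11  Theorem 2: the weakly nonoverlapping class is closed under FAST-EXPANSION-SUM

The induction over the loop carries, for the list of outputs still to come: nonoverlapping
(as in Theorem 1), pairwise `WeakBelow`, triplewise `NoDouble`, and the ADJACENCY WITNESS: if an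
output `a` is adjacent to a later output then some component unprocessed when `a` was emitted is an
odd multiple of `2^(⌊log₂|a|⌋+1)`.  A double adjacency `h — w₁ — w₂` would make `w₁ = ±2^(T+1)`
(`T = ⌊log₂|h|⌋`), its witness an odd multiple of `2^(T+2)`, and `h`'s witness an odd multiple of
`2^(T+1)` — excluded by §9. -/

/-- The loop from any state of the strengthened invariant, under a rounding with 2-below roundoff,
yields a weakly nonoverlapping expansion (with adjacency witnesses). -/
theorem FesInvW.isWeakExpansion_growExpansion (hp : 4 ≤ p) (hfl : IsRoundNearest p emin fl)
    (hfl2 : RoundoffBelow 2 fl) {e f : List ℚ}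
    (heF : ∀ x ∈ e, IsFloat p emin x) (hes : IsWeakExpansion e)
    (hfF : ∀ x ∈ f, IsFloat p emin x) (hfs : IsWeakExpansion f) :
    ∀ (rs e₁ f₁ e₂ f₂ : List ℚ) (Q : ℚ) (hs : List ℚ) (g : ℤ), mergeExpansions e₂ f₂ = rs →
      FesInvW p emin e f e₁ f₁ e₂ f₂ Q hs g →
      IsExpansion 1 (growExpansion fl rs Q) ∧ (growExpansion fl rs Q).Pairwise WeakBelow ∧
        (growExpansion fl rs Q).Triplewise NoDouble ∧
        (growExpansion fl rs Q).Pairwise (AdjW rs) := by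
  have hp1 : 1 ≤ p := le_trans (by norm_num) hp
  have h2 : (0 : ℚ) < 2 := by norm_num
  intro rs
  induction rs with
  | nil =>
    intro e₁ f₁ e₂ f₂ Q hs g _ _
    rw [growExpansion_nil]
    exact ⟨isExpansion_singleton 1 Q, List.pairwise_singleton _ _, List.triplewise_singleton _ _,
      List.pairwise_singleton _ _⟩
  | cons z rs ih =>
    intro e₁ f₁ e₂ f₂ Q hs g hm hI
    rw [growExpansion_cons]
    obtain ⟨e₁', f₁', e₂', f₂', g', hrs, hI', hlt, hfacts⟩ :=
      hI.advance₂ hp hfl hfl2 heF hes hfF hfs hm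
    set Q' := (twoSum fl Q z).1 with hQ'def
    set h := (twoSum fl Q z).2 with hhdef
    obtain ⟨hexp', hwb', hnd', hadj'⟩ := ih e₁' f₁' e₂' f₂' Q' _ g' hrs hI'
    have hrsF : ∀ x ∈ rs, IsFloat p emin x := fun x hx => by
      rw [← hrs, mem_mergeExpansions] at hx
      exact hx.elim (fun hx => heF x (by rw [hI'.inv.he]; exact List.mem_append_right _ hx))
        fun hx => hfF x (by rw [hI'.inv.hf]; exact List.mem_append_right _ hx)
    have hrsG : ∀ x ∈ rs, OnGrid g' x := fun x hx => by
      rw [← hrs, mem_mergeExpansions] at hx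
      exact hI'.inv.hrg x (List.mem_append.mpr hx)
    have hQ'F : IsFloat p emin Q' := hI'.inv.hQ
    have hoF : ∀ w ∈ growExpansion fl rs Q', IsFloat p emin w :=
      isFloat_of_mem_growExpansion hfl hQ'F
    have hb1 : ∀ w ∈ growExpansion fl rs Q', Below 1 h w := fun w hw =>
      ⟨g', onGrid_of_mem_growExpansion hp1 hfl hI'.inv.hg hQ'F hrsF hI'.inv.hQg hrsG w hw,
        by rw [one_mul]; exact hlt⟩
    -- if `h` is 2-below every later output, everything is immediate
    have easy : (∀ w ∈ growExpansion fl rs Q', Below 2 h w) →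
        IsExpansion 1 (h :: growExpansion fl rs Q') ∧
          (h :: growExpansion fl rs Q').Pairwise WeakBelow ∧
          (h :: growExpansion fl rs Q').Triplewise NoDouble ∧
          (h :: growExpansion fl rs Q').Pairwise (AdjW (z :: rs)) := fun hb2 =>
      ⟨isExpansion_cons.mpr ⟨hb1, hexp'⟩,
        List.pairwise_cons.mpr ⟨fun w hw => Or.inl (hb2 w hw), hwb'⟩,
        List.triplewise_cons.mpr ⟨hwb'.imp_of_mem fun ha _ _ => Or.inl (hb2 _ ha), hnd'⟩,
        List.pairwise_cons.mpr ⟨fun w hw hnb => absurd (hb2 w hw) hnb,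
          hadj'.imp fun hab => hab.mono z⟩⟩
    by_cases hh0 : h = 0
    · exact easy fun w hw => hh0 ▸ below_zero_left (hoF w hw) 2
    obtain ⟨hg'eq, hF⟩ := hfacts hh0
    set T := Int.log 2 |h| with hTdef
    have hTh : (2 : ℚ) ^ T ≤ |h| := zpow_log_le_abs hh0
    have hhT : |h| < (2 : ℚ) ^ (T + 1) := abs_lt_zpow_log_succ h
    have heT2 : emin ≤ T + 2 := by have := hI'.inv.hg; omega
    have hpT1 : (2 : ℚ) ^ (T + 1) = 2 * (2 : ℚ) ^ T := by rw [zpow_add_one₀ h2.ne']; ring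
    have hpT2 : (2 : ℚ) ^ (T + 2) = 4 * (2 : ℚ) ^ T := by rw [zpow_add₀ h2.ne']; norm_num; ring
    rcases hF.dich with hall | ⟨habs, x₀, hx₀, M₀, hM₀, hx₀e⟩
    · -- all later data on the grid `2^(T+2)`: `h` is 2-below every later output
      exact easy fun w hw => ⟨T + 2,
        onGrid_of_mem_growExpansion hp1 hfl heT2 hQ'F hrsF hF.gridQ hall w hw,
        by rw [hpT2]; rw [hpT1] at hhT; linarith⟩
    · -- `|h| = 2^T` with a witness `x₀`: weakly below everything; no double adjacency by §9
      refine ⟨isExpansion_cons.mpr ⟨hb1, hexp'⟩,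
        List.pairwise_cons.mpr ⟨fun w hw => Or.inr ⟨hb1 w hw, T, habs⟩, hwb'⟩,
        List.triplewise_cons.mpr ⟨?_, hnd'⟩,
        List.pairwise_cons.mpr ⟨fun w hw _ => ⟨x₀, List.mem_cons_of_mem z hx₀, M₀, hM₀, hx₀e⟩,
          hadj'.imp fun hab => hab.mono z⟩⟩
      refine (hwb'.and hadj').imp_of_mem fun {w₁ w₂} hw₁ _ hww => ?_
      obtain ⟨hwb, hadj⟩ := hww
      by_cases hb : Below 2 h w₁
      · exact Or.inl hb
      right
      by_contra hnb2
      have hw₁0 : w₁ ≠ 0 := fun h0 => hb (h0 ▸ below_zero_right 2 h)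
      rcases hwb with hb2' | ⟨-, a, ha⟩
      · exact hnb2 hb2'
      obtain ⟨M₁, v₁, hM₁, -, -, hw₁e⟩ := exists_odd_mul_two_zpow (hoF w₁ hw₁) hw₁0
      -- `w₁` is an odd multiple of exactly `2^(T+1)`, and a power of two: `|w₁| = 2^(T+1)`
      have hv1 : T + 1 ≤ v₁ := by
        obtain ⟨s, hs, hlt1⟩ := hb1 w₁ hw₁
        have hsv : s ≤ v₁ := OnGrid.le_of_odd hM₁ (by rwa [hw₁e] at hs)
        rw [one_mul, habs] at hlt1
        have := (zpow_lt_zpow_iff_right₀ (by norm_num : (1:ℚ) < 2)).mp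
          (lt_of_lt_of_le hlt1 (zpow_le_zpow_right₀ (by norm_num) hsv))
        omega
      have hv2 : v₁ ≤ T + 1 := by
        by_contra hlt2
        push Not at hlt2
        refine hb ⟨v₁, ⟨M₁, hw₁e⟩, ?_⟩
        rw [habs, ← hpT1]
        exact zpow_lt_zpow_right₀ (by norm_num) (by omega)
      have hv : v₁ = T + 1 := le_antisymm hv2 hv1
      rw [hw₁e] at ha
      obtain ⟨hM1abs, -⟩ := abs_eq_one_of_odd_of_abs_eq_two_zpow hM₁ ha
      have hlog : Int.log 2 |w₁| = T + 1 := by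
        rw [hw₁e, abs_mul, abs_of_pos (zpow_pos h2 _),
          show |(M₁ : ℚ)| = 1 by exact_mod_cast hM1abs, one_mul, hv]
        have := Int.log_zpow (R := ℚ) (b := 2) (by norm_num) (T + 1)
        exact_mod_cast this
      obtain ⟨y, hy, My, hMy, hye⟩ := hadj hnb2
      rw [hlog, show T + 1 + 1 = T + 2 by ring] at hye
      exact hF.noTwo x₀ hx₀ y hy M₀ My hM₀ hMy hx₀e hye

/-- **THEOREM 2 (closure; what makes FAST-EXPANSION-SUM composable).**  For any precision `p ≥ 4`
and any round-to-nearest rounding whose roundoff is 2-below its result (`RoundoffBelow 2`, e.g.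
IEEE round-half-even, `roundoffBelow_two_roundTiesEven`): if `e` and `f` are weakly nonoverlapping
expansions then so is `FAST-EXPANSION-SUM(e, f)`.  (Under round-half-away, round-half-to-zero or
round-half-to-odd this FAILS — see the module docstring.) -/
theorem fastExpansionSum_isWeakExpansion (hp : 4 ≤ p) (hfl : IsRoundNearest p emin fl)
    (hfl2 : RoundoffBelow 2 fl) {e f : List ℚ}
    (heF : ∀ x ∈ e, IsFloat p emin x) (hes : IsWeakExpansion e)
    (hfF : ∀ x ∈ f, IsFloat p emin x) (hfs : IsWeakExpansion f) :
    IsWeakExpansion (fastExpansionSum fl e f) := by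
  have hp1 : 1 ≤ p := le_trans (by norm_num) hp
  have hgF : ∀ x ∈ mergeExpansions e f, IsFloat p emin x := fun x hx =>
    (mem_mergeExpansions.mp hx).elim (heF x) (hfF x)
  have hmain := FesInvW.isWeakExpansion_growExpansion hp hfl hfl2 heF hes hfF hfs
    (mergeExpansions e f) [] [] e f 0 [] emin rfl (FesInvW.init heF hfF)
  rcases hm : mergeExpansions e f with _ | ⟨g₁, gs⟩
  · simp only [fastExpansionSum, hm]; exact isWeakExpansion_nil
  · rw [fastExpansionSum_eq_growExpansion hp1 hfl heF hfF hes.pairwise_abs_le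
      hfs.pairwise_abs_le hm]
    rw [hm, growExpansion_cons, twoSum_zero_left hfl (hgF g₁ (hm ▸ List.mem_cons_self))] at hmain
    exact ⟨(List.pairwise_cons.mp hmain.2.1).2, (List.triplewise_cons.mp hmain.2.2.1).2⟩

/-- Theorem 2 for IEEE-754 round-half-even. -/
theorem fastExpansionSum_isWeakExpansion_roundTiesEven (hp : 4 ≤ p) {e f : List ℚ}
    (heF : ∀ x ∈ e, IsFloat p emin x) (hes : IsWeakExpansion e)
    (hfF : ∀ x ∈ f, IsFloat p emin x) (hfs : IsWeakExpansion f) :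
    IsWeakExpansion (fastExpansionSum (roundTiesEven p emin) e f) :=
  fastExpansionSum_isWeakExpansion hp (isRoundNearest_roundTiesEven (le_trans (by norm_num) hp))
    (roundoffBelow_two_roundTiesEven p emin) heF hes hfF hfs

/-- Theorems 1 and 2 together, for round-half-even: the sum of two weakly nonoverlapping expansions
is a weakly nonoverlapping (in particular nonoverlapping) expansion with the right sum and length —
so FAST-EXPANSION-SUM can be iterated on its own outputs. -/
theorem fastExpansionSum_spec_roundTiesEven (hp : 4 ≤ p) {e f : List ℚ}
    (heF : ∀ x ∈ e, IsFloat p emin x) (hes : IsWeakExpansion e)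
    (hfF : ∀ x ∈ f, IsFloat p emin x) (hfs : IsWeakExpansion f) :
    IsWeakExpansion (fastExpansionSum (roundTiesEven p emin) e f) ∧
      (fastExpansionSum (roundTiesEven p emin) e f).sum = e.sum + f.sum ∧
      (fastExpansionSum (roundTiesEven p emin) e f).length = e.length + f.length ∧
      ∀ x ∈ fastExpansionSum (roundTiesEven p emin) e f, IsFloat p emin x :=
  have hfl := isRoundNearest_roundTiesEven (emin := emin) (le_trans (by norm_num) hp)
  ⟨fastExpansionSum_isWeakExpansion_roundTiesEven hp heF hes hfF hfs,
    (fastExpansionSum_nonoverlapping_of_isWeakExpansion hp hfl heF hes hfF hfs).2⟩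

end Summit.Ventures.CertifiedArithmetic.Expansions
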